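import Literature.AlgebraicGeometry.Resolution.RegularLocalRingsFlatDescent
import Mathlib.RingTheory.RingHom.Flat
import Mathlib.RingTheory.Flat.Stability
import Mathlib.RingTheory.Localization.AtPrime.Basic
import Mathlib.RingTheory.Localization.Submodule
import Mathlib.RingTheory.TensorProduct.Basic

/-!
# `Valuative.TorsorToLurel`: flat descent of regularity along `B → B ⊗ₖ k'`

Route `ResolutionOfSingularities/Valuative`, support item `TorsorToLurel`
(stmt-ResolutionOfSingularities-10968), line `Sketch` (perfect-closure descent). Helper file.

`stub_ttlFlatDescent`: for a Noetherian `k`-algebra `B`, a field extension `k'/k`, a prime `𝔔`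
of `B ⊗ₖ k'` lying over the prime `𝔮` of `B`, if `(B ⊗ₖ k')_𝔔` is a regular local ring then so
is `B_𝔮`. This is Matsumura, *Commutative Ring Theory*, Thm. 23.7 (i) (in tree:
`Literature.AlgebraicGeometry.Resolution.IsRegularLocalRing.of_flat_ringHom`) applied to the
flat local homomorphism `B_𝔮 → (B ⊗ₖ k')_𝔔` induced by the flat (indeed free) base change
`B → B ⊗ₖ k'` (Mathlib `RingHom.Flat.localRingHom`).
-/

noncomputable section

set_option linter.dupNamespace false -- mandated namespace of this single-conjunct summit

open IsLocalRing
open scoped TensorProduct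

namespace Summit.ResolutionOfSingularities.ResolutionOfSingularities.Theorems

/-- **Flat descent of regularity along `B → B ⊗ₖ k'`** (Matsumura, CRT, Thm. 23.7 (i)): if the
prime `𝔔` of `B ⊗ₖ k'` lies over the prime `𝔮` of the Noetherian `k`-algebra `B` and
`(B ⊗ₖ k')_𝔔` is regular, then `B_𝔮` is regular — the induced local homomorphism
`B_𝔮 → (B ⊗ₖ k')_𝔔` is flat because `B ⊗ₖ k'` is a flat (free) `B`-module. -/
theorem stub_ttlFlatDescent (k B k' : Type) [Field k] [CommRing B] [Algebra k B] [IsNoetherianRing B]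
    [Field k'] [Algebra k k'] (𝔮 : Ideal B) [𝔮.IsPrime] (𝔔 : Ideal (B ⊗[k] k')) [𝔔.IsPrime]
    (h𝔔 : 𝔔.comap (algebraMap B (B ⊗[k] k')) = 𝔮)
    (hreg : IsRegularLocalRing (Localization.AtPrime 𝔔)) :
    IsRegularLocalRing (Localization.AtPrime 𝔮) := by
  haveI := hreg
  haveI : IsNoetherianRing (Localization.AtPrime 𝔮) :=
    IsLocalization.isNoetherianRing 𝔮.primeCompl _ inferInstance
  have hflat : (algebraMap B (B ⊗[k] k')).Flat :=
    RingHom.flat_algebraMap_iff.mpr inferInstance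
  exact Literature.AlgebraicGeometry.Resolution.IsRegularLocalRing.of_flat_ringHom
    (Localization.localRingHom 𝔮 𝔔 (algebraMap B (B ⊗[k] k')) h𝔔.symm)
    (hflat.localRingHom 𝔔 𝔮 h𝔔.symm)

end Summit.ResolutionOfSingularities.ResolutionOfSingularities.Theorems

end
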